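import Summits.NavierStokesRegularity.FunctionalMining.QuadraticBudgetWitness
import Summits.NavierStokesRegularity.FunctionalMining.NoGo.SeparableCalculus
import HarnessLib

/-!
# The log-door witness: the `±` expansion of the bi-Laplacian production and locality

Search for candidate a priori estimates; no regularity claim. NS FUNCTIONAL MINING — NO-GO BRANCH
(cell `pub-nsfunc`, prove seat gen 3). Abstract bookkeeping for the no-go N6 on `ℝ³`, for smooth
compactly supported fields `G, W`:
* `production2_add_add_sub`: with `P₂(v) = ∫⟪Dv(v), Δ²v⟫`,
  `P₂(G+W) + P₂(G−W) = 2P₂(G) + 2∫(⟪DW(W), Δ²G⟫ + ⟪DG(W), Δ²W⟫ + ⟪DW(G), Δ²W⟫)` — the sign trick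
  isolating the `W`-quadratic part (the second variation);
* `laplacianNormSq_add_add_sub`: `∫‖Δ(G+W)‖² + ∫‖Δ(G−W)‖² = 2∫‖ΔG‖² + 2∫‖ΔW‖²` (parallelogram);
* `secondVariation_congr_of_local`: the second-variation integrand only sees `G` where `W` lives —
  if `G = E` on an open set off which `W` vanishes locally, the integrands for `(G, W)` and `(E, W)`
  agree pointwise.
Folklore calculus; nothing is asserted about Navier–Stokes.
-/

open MeasureTheory Set Function Filter
open scoped ContDiff Topology Laplacian InnerProductSpace RealInnerProductSpace

namespace Summit.NavierStokesRegularity.FunctionalMining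

namespace Sep3

open Literature.Analysis.FluidPDE

/-- `∞ ≠ 0` in `WithTop ℕ∞`. [folklore] -/
private theorem infty_ne_zero₇ : (∞ : WithTop ℕ∞) ≠ 0 := by simp

/-- `2 ≤ ∞` in `WithTop ℕ∞`. [folklore] -/
private theorem two_le_infty₇ : (2 : WithTop ℕ∞) ≤ ∞ := by
  change ((2 : ℕ∞) : WithTop ℕ∞) ≤ ((⊤ : ℕ∞) : WithTop ℕ∞)
  exact_mod_cast (le_top : (2 : ℕ∞) ≤ ⊤)

section Fields

variable {G W : E3 → E3}

/-- `Δ²(G + W) = Δ²G + Δ²W` for smooth fields. [folklore] -/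
theorem laplacian2_add (hG : ContDiff ℝ ∞ G) (hW : ContDiff ℝ ∞ W) (y : E3) :
    Δ (Δ (fun z => G z + W z)) y = Δ (Δ G) y + Δ (Δ W) y := by
  have h1 : Δ (fun z => G z + W z) = fun z => Δ G z + Δ W z := by
    funext z
    exact ContDiffAt.laplacian_add (hG.of_le two_le_infty₇).contDiffAt (hW.of_le two_le_infty₇).contDiffAt
  rw [h1]
  exact ContDiffAt.laplacian_add ((BumpWitness.contDiff_laplacian_of_smooth hG).of_le two_le_infty₇).contDiffAt
    ((BumpWitness.contDiff_laplacian_of_smooth hW).of_le two_le_infty₇).contDiffAt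

/-- `Δ²(G − W) = Δ²G − Δ²W` for smooth fields. [folklore] -/
theorem laplacian2_sub (hG : ContDiff ℝ ∞ G) (hW : ContDiff ℝ ∞ W) (y : E3) :
    Δ (Δ (fun z => G z - W z)) y = Δ (Δ G) y - Δ (Δ W) y := by
  have h1 : Δ (fun z => G z - W z) = fun z => Δ G z - Δ W z := by
    funext z
    exact ContDiffAt.laplacian_sub (hG.of_le two_le_infty₇).contDiffAt (hW.of_le two_le_infty₇).contDiffAt
  rw [h1]
  exact ContDiffAt.laplacian_sub ((BumpWitness.contDiff_laplacian_of_smooth hG).of_le two_le_infty₇).contDiffAt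
    ((BumpWitness.contDiff_laplacian_of_smooth hW).of_le two_le_infty₇).contDiffAt

/-- `Δ²` of a smooth field is continuous. [folklore] -/
theorem continuous_laplacian2 (hG : ContDiff ℝ ∞ G) : Continuous (Δ (Δ G)) :=
  (BumpWitness.contDiff_laplacian_of_smooth (BumpWitness.contDiff_laplacian_of_smooth hG)).continuous

/-- `y ↦ DF(y)(v(y))` is continuous for smooth `F` and continuous `v`. [folklore] -/
theorem continuous_fderiv_apply {F : E3 → E3} {v : E3 → E3} (hF : ContDiff ℝ ∞ F) (hv : Continuous v) :
    Continuous fun y => fderiv ℝ F y (v y) :=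
  (hF.continuous_fderiv infty_ne_zero₇).clm_apply hv

/-- A continuous function vanishing off the union of two compact supports is integrable. [folklore] -/
theorem integrable_of_vanish {f : E3 → ℝ} (hf : Continuous f) (hGc : HasCompactSupport G)
    (hWc : HasCompactSupport W) (h : ∀ y, G y = 0 → W y = 0 → f y = 0) : Integrable f := by
  refine hf.integrable_of_hasCompactSupport (HasCompactSupport.intro (hGc.union hWc) fun y hy => ?_)
  rw [mem_union, not_or] at hy
  exact h y (image_eq_zero_of_notMem_tsupport hy.1) (image_eq_zero_of_notMem_tsupport hy.2)

/-- **The `±` expansion of the bi-Laplacian production.** For smooth compactly supported `G, W`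
on `ℝ³`, with `P₂(v) = ∫⟪Dv(v), Δ²v⟫`:
`P₂(G+W) + P₂(G−W) = 2 P₂(G) + 2 ∫ (⟪DW(W), Δ²G⟫ + ⟪DG(W), Δ²W⟫ + ⟪DW(G), Δ²W⟫)`. [folklore] -/
theorem production2_add_add_sub (hG : ContDiff ℝ ∞ G) (hW : ContDiff ℝ ∞ W) (hGc : HasCompactSupport G)
    (hWc : HasCompactSupport W) :
    (∫ y, ⟪fderiv ℝ (fun z => G z + W z) y (G y + W y), Δ (Δ (fun z => G z + W z)) y⟫) +
      (∫ y, ⟪fderiv ℝ (fun z => G z - W z) y (G y - W y), Δ (Δ (fun z => G z - W z)) y⟫) =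
      2 * (∫ y, ⟪fderiv ℝ G y (G y), Δ (Δ G) y⟫) +
      2 * ∫ y, (⟪fderiv ℝ W y (W y), Δ (Δ G) y⟫ + ⟪fderiv ℝ G y (W y), Δ (Δ W) y⟫ +
        ⟪fderiv ℝ W y (G y), Δ (Δ W) y⟫) := by
  have hGd : Differentiable ℝ G := hG.differentiable infty_ne_zero₇
  have hWd : Differentiable ℝ W := hW.differentiable infty_ne_zero₇
  -- pointwise identity
  have hpt : ∀ y, ⟪fderiv ℝ (fun z => G z + W z) y (G y + W y), Δ (Δ (fun z => G z + W z)) y⟫ +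
      ⟪fderiv ℝ (fun z => G z - W z) y (G y - W y), Δ (Δ (fun z => G z - W z)) y⟫ =
      2 * ⟪fderiv ℝ G y (G y), Δ (Δ G) y⟫ +
      2 * (⟪fderiv ℝ W y (W y), Δ (Δ G) y⟫ + ⟪fderiv ℝ G y (W y), Δ (Δ W) y⟫ +
        ⟪fderiv ℝ W y (G y), Δ (Δ W) y⟫) := by
    intro y
    rw [fderiv_fun_add (hGd y) (hWd y), fderiv_fun_sub (hGd y) (hWd y), laplacian2_add hG hW,
      laplacian2_sub hG hW]
    simp only [add_apply, sub_apply, map_add, map_sub, inner_add_left, inner_add_right, inner_sub_left,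
      inner_sub_right]
    ring
  -- continuity of all integrands
  have cG := hG.continuous
  have cW := hW.continuous
  have cLG := continuous_laplacian2 hG
  have cLW := continuous_laplacian2 hW
  have hGW : ContDiff ℝ ∞ (fun z => G z + W z) := hG.add hW
  have hGW' : ContDiff ℝ ∞ (fun z => G z - W z) := hG.sub hW
  have i1 : Integrable (fun y => ⟪fderiv ℝ (fun z => G z + W z) y (G y + W y),
      Δ (Δ (fun z => G z + W z)) y⟫) := by
    refine integrable_of_vanish ((continuous_fderiv_apply hGW (cG.add cW)).inner
      (continuous_laplacian2 hGW)) hGc hWc fun y h1 h2 => ?_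
    simp [h1, h2]
  have i2 : Integrable (fun y => ⟪fderiv ℝ (fun z => G z - W z) y (G y - W y),
      Δ (Δ (fun z => G z - W z)) y⟫) := by
    refine integrable_of_vanish ((continuous_fderiv_apply hGW' (cG.sub cW)).inner
      (continuous_laplacian2 hGW')) hGc hWc fun y h1 h2 => ?_
    simp [h1, h2]
  have iA : Integrable (fun y => ⟪fderiv ℝ G y (G y), Δ (Δ G) y⟫) := by
    refine integrable_of_vanish ((continuous_fderiv_apply hG cG).inner cLG) hGc hWc fun y h1 _ => ?_
    simp [h1]
  have iB : Integrable (fun y => ⟪fderiv ℝ W y (W y), Δ (Δ G) y⟫ + ⟪fderiv ℝ G y (W y), Δ (Δ W) y⟫ +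
      ⟪fderiv ℝ W y (G y), Δ (Δ W) y⟫) := by
    refine integrable_of_vanish ((((continuous_fderiv_apply hW cW).inner cLG).add
      ((continuous_fderiv_apply hG cW).inner cLW)).add ((continuous_fderiv_apply hW cG).inner cLW))
      hGc hWc fun y h1 h2 => ?_
    simp [h1, h2]
  rw [← integral_add i1 i2, integral_congr_ae (ae_of_all _ hpt), integral_add (iA.const_mul 2)
    (iB.const_mul 2), integral_const_mul, integral_const_mul]

/-- **Parallelogram law for the palinstrophy**: `∫‖Δ(G+W)‖² + ∫‖Δ(G−W)‖² = 2∫‖ΔG‖² + 2∫‖ΔW‖²`.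
[folklore] -/
theorem laplacianNormSq_add_add_sub (hG : ContDiff ℝ ∞ G) (hW : ContDiff ℝ ∞ W)
    (hGc : HasCompactSupport G) (hWc : HasCompactSupport W) :
    (∫ y, ‖Δ (fun z => G z + W z) y‖ ^ 2) + (∫ y, ‖Δ (fun z => G z - W z) y‖ ^ 2) =
      2 * (∫ y, ‖Δ G y‖ ^ 2) + 2 * ∫ y, ‖Δ W y‖ ^ 2 := by
  have hΔa : Δ (fun z => G z + W z) = fun z => Δ G z + Δ W z := by
    funext z
    exact ContDiffAt.laplacian_add (hG.of_le two_le_infty₇).contDiffAt (hW.of_le two_le_infty₇).contDiffAt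
  have hΔs : Δ (fun z => G z - W z) = fun z => Δ G z - Δ W z := by
    funext z
    exact ContDiffAt.laplacian_sub (hG.of_le two_le_infty₇).contDiffAt (hW.of_le two_le_infty₇).contDiffAt
  have hpt : ∀ y, ‖Δ (fun z => G z + W z) y‖ ^ 2 + ‖Δ (fun z => G z - W z) y‖ ^ 2 =
      2 * ‖Δ G y‖ ^ 2 + 2 * ‖Δ W y‖ ^ 2 := by
    intro y
    rw [hΔa, hΔs]
    dsimp only
    rw [norm_add_sq_real, norm_sub_sq_real]
    ring
  have cLG := (BumpWitness.contDiff_laplacian_of_smooth hG).continuous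
  have cLW := (BumpWitness.contDiff_laplacian_of_smooth hW).continuous
  have i1 : Integrable (fun y => ‖Δ (fun z => G z + W z) y‖ ^ 2) := by
    rw [hΔa]
    refine ((cLG.add cLW).norm.pow 2).integrable_of_hasCompactSupport
      (HasCompactSupport.intro (hGc.union hWc) fun y hy => ?_)
    rw [mem_union, not_or] at hy
    simp [laplacian_eq_zero_of_notMem_tsupport hy.1, laplacian_eq_zero_of_notMem_tsupport hy.2]
  have i2 : Integrable (fun y => ‖Δ (fun z => G z - W z) y‖ ^ 2) := by
    rw [hΔs]
    refine ((cLG.sub cLW).norm.pow 2).integrable_of_hasCompactSupport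
      (HasCompactSupport.intro (hGc.union hWc) fun y hy => ?_)
    rw [mem_union, not_or] at hy
    simp [laplacian_eq_zero_of_notMem_tsupport hy.1, laplacian_eq_zero_of_notMem_tsupport hy.2]
  have iA : Integrable (fun y => ‖Δ G y‖ ^ 2) :=
    (cLG.norm.pow 2).integrable_of_hasCompactSupport
      (HasCompactSupport.intro hGc fun y hy => by simp [laplacian_eq_zero_of_notMem_tsupport hy])
  have iB : Integrable (fun y => ‖Δ W y‖ ^ 2) :=
    (cLW.norm.pow 2).integrable_of_hasCompactSupport
      (HasCompactSupport.intro hWc fun y hy => by simp [laplacian_eq_zero_of_notMem_tsupport hy])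
  rw [← integral_add i1 i2, integral_congr_ae (ae_of_all _ hpt), integral_add (iA.const_mul 2)
    (iB.const_mul 2), integral_const_mul, integral_const_mul]

/-- **Locality of the second variation.** If `G = E` on an open set `U` and `W` vanishes near every
point outside `U`, the second-variation integrands for `(G, W)` and `(E, W)` agree pointwise.
[folklore] -/
theorem secondVariation_congr_of_local {E : E3 → E3} {U : Set E3} (hU : IsOpen U)
    (hGE : ∀ y ∈ U, G y = E y) (hWU : ∀ y, y ∉ U → W =ᶠ[𝓝 y] fun _ => 0) (y : E3) :
    ⟪fderiv ℝ W y (W y), Δ (Δ G) y⟫ + ⟪fderiv ℝ G y (W y), Δ (Δ W) y⟫ + ⟪fderiv ℝ W y (G y), Δ (Δ W) y⟫ =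
      ⟪fderiv ℝ W y (W y), Δ (Δ E) y⟫ + ⟪fderiv ℝ E y (W y), Δ (Δ W) y⟫ +
        ⟪fderiv ℝ W y (E y), Δ (Δ W) y⟫ := by
  by_cases hy : y ∈ U
  · have hev : G =ᶠ[𝓝 y] E := eventuallyEq_of_mem (hU.mem_nhds hy) fun z hz => hGE z hz
    have h1 : fderiv ℝ G y = fderiv ℝ E y := hev.fderiv_eq
    have h2 : Δ (Δ G) y = Δ (Δ E) y :=
      (InnerProductSpace.laplacian_congr_nhds (InnerProductSpace.laplacian_congr_nhds hev)).eq_of_nhds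
    rw [h1, h2, hGE y hy]
  · have hev := hWU y hy
    have h0 : W y = 0 := hev.eq_of_nhds
    have h1 : fderiv ℝ W y = 0 := by rw [hev.fderiv_eq]; simp
    have h2 : Δ (Δ W) y = 0 := by
      have e1 : Δ W =ᶠ[𝓝 y] Δ (fun _ : E3 => (0 : E3)) := InnerProductSpace.laplacian_congr_nhds hev
      rw [InnerProductSpace.laplacian_const] at e1
      have e2 := (InnerProductSpace.laplacian_congr_nhds e1).eq_of_nhds
      rw [e2, Pi.zero_def, InnerProductSpace.laplacian_const]; rfl
    rw [h0, h1, h2]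
    simp

end Fields

end Sep3

end Summit.NavierStokesRegularity.FunctionalMining
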